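/-
Copyright (c) 2026. All rights reserved.
Released under Apache 2.0 license as described in the file LICENSE.
-/
import Literature.NumberTheory.ComplexMultiplication.DegenerateCMTypesElementaryAbelianOrderThirtyTwo
import Literature.NumberTheory.ComplexMultiplication.DegenerateCMTypesElementaryAbelianStabilizerRank
import HarnessLib

/-!
# CM types on the elementary abelian group of order `32`: the sign-count profile of each rank, and the STABILISERS —
# ranks `2, 5, 9` are imprimitive, ranks `11, 17` are primitive

Sequel of the tree's `DegenerateCMTypesElementaryAbelianOrderThirtyTwo` (seat p10 g38-#6: on a finite commutative
group `G` of exponent `2` and order `32` every CM type `T` has Kubota rank `2, 5, 9, 11` or `17`; T. Kubota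
[Kubota1965] §4 Lemma 2, the balance lemma) and `DegenerateCMTypesElementaryAbelianStabilizerRank` (g38-#8, every
order: a non-trivial stabiliser forces `rank ≤ |G|/4 + 1`; rank `5` forces `|G| ≤ 8·|Stab(T)|`).  With
`a_χ(T) = #{t ∈ T : χ(t) = −1}` (`Ŝ(χ) = 16 − 2a_χ(T)`) and `n_v = #{χ odd : (8 − a_χ)² = v}`, the Parseval/balance
system `16n₆₄ + 9n₃₆ + 4n₁₆ + n₄ = 16`, `n₃₆ + n₄ ∈ {0, 8, 16}` has exactly five solutions, one per rank, so THE RANK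
DETERMINES THE PROFILE OF THE SIGN COUNTS (§1): rank `2`: one `|Ŝ| = 16`; rank `5`: four `|Ŝ| = 8`; rank `9`: one
`|Ŝ| = 12` and seven `|Ŝ| = 4`; rank `11`: two `|Ŝ| = 8` and eight `|Ŝ| = 4`; rank `17`: sixteen `|Ŝ| = 4` (even
type) or an odd type.  Consequences for the STABILISER `Stab(T) = ⋂_{survivors} ker χ` (tree
`AbelianStabilizer.forall_mul_mem_iff_iff_forall_survivor`), order `32`:

> Rank `9` ⟹ some `a_χ(T) ∈ {2, 14}` (`exists_card_filter_mem_of_typeRank_eq_nine`), so `T` is at distance one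
> conjugate pair from an index-`2` coset and is stabilised by a `g ≠ 1` (tree `WeightTwo`;
> `exists_ne_one_forall_mul_mem_iff_of_typeRank_eq_nine`); rank `5` ⟹ `|Stab(T)| ≥ 4` (tree, g38-#8); rank `2` ⟹
> `Stab(T) ⊇` an index-`2` subgroup (`exists_ne_one_forall_mul_mem_iff_of_typeRank_eq_two`); rank `11` or `17` ⟹
> `Stab(T) = 1` (`eq_one_of_forall_mul_mem_iff_of_nine_lt_typeRank`).  So: **IMPRIMITIVE ⟺ RANK ∈ {2, 5, 9},
> PRIMITIVE ⟺ RANK ∈ {11, 17}** (`exists_ne_one_forall_mul_mem_iff_iff_typeRank_le_nine`,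
> `typeRank_eq_eleven_or_seventeen_of_forall`).

On the field side (multiquadratic CM fields of degree `32`, `g = 16`; sequel in `Pohlmann1968/`): a simple abelian
`16`-fold with CM by such a field has Mumford–Tate rank `11` (degenerate: exceptional Hodge classes on some power) or
`17`; every non-simple one comes from a NONDEGENERATE type of a subfield of degree `2`, `8` or `16`.

* §1 `profile_of_card_thirtytwo` (the five solutions), `forall_even_of_typeRank_ne_of_card_thirtytwo`,
  `exists_card_filter_mem_of_typeRank_eq_nine`.
* §2 `exists_ne_one_forall_mul_mem_iff_of_typeRank_eq_nine`, `exists_ne_one_forall_mul_mem_iff_of_typeRank_eq_two`,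
  `eq_one_of_forall_mul_mem_iff_of_nine_lt_typeRank`, **`exists_ne_one_forall_mul_mem_iff_iff_typeRank_le_nine`**,
  `typeRank_eq_eleven_or_seventeen_of_forall`.

HONEST SCOPE.  Elementary consequences of the order-`32` spectrum and the joint-kernel description of the stabiliser;
the sources print Kubota's formula and the weight dictionary; this regrouping (for Boolean functions of four
variables: the functions with a linear structure are exactly those of Walsh support `≤ 8`) is the file's.  THEOREMS
ONLY: no definition, no named fact, no instance, no `sorry`.

## References

* [Kubota1965] T. Kubota, *On the field extension by complex multiplication*, Trans. AMS 118 (1965), §2, §4 Lemma 2.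
* [Gordon1999HodgeAVSurvey] B. B. Gordon, *A survey of the Hodge conjecture for abelian varieties*, Prop. 9.4.1.
* [Dodson1984] B. Dodson, *The structure of Galois groups of CM-fields*, Trans. AMS 283 (1984), §3.1.1 Theorem.
* [Carlet2020] C. Carlet, *Boolean Functions for Cryptography and Coding Theory*, CUP, §2.3.

## Provenance

Lane `lit-hodgefound` (Track 2, Layer A3), seat `lit-hodgefound-p10` generation 38, row g38-#7; neighbours cited by
name, nothing restated: `DegenerateCMTypesElementaryAbelianOrderThirtyTwo` (`card_filter_mod_four_mem`,
`two_mul_card_odd_eq`, `typeRank_mem_of_card_thirtytwo`), `DegenerateCMTypesElementaryAbelianStabilizerRank`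
(`typeRank_le_of_forall_mul_mem_iff`, `exists_ne_one_forall_mul_mem_iff_of_typeRank_eq_five_of_le`),
`DegenerateCMTypesAbelianStabilizerCharacters` (`AbelianStabilizer.forall_mul_mem_iff_of_forall_survivor`),
`DegenerateCMTypesElementaryAbelianWeightTwo` (`sum_char_ne_zero_iff_apply_mul_eq_one`, `card_filter_compl_add_eq`,
`isCMTypeWith_compl`), `DegenerateCMTypesElementaryAbelianTwoGroup` (`sum_char_eq_zero_iff_two_mul_card_filter_eq`,
`even_card_filter_of_typeRank_ne`, `sum_odd_sq_eq_int`, `typeRank_eq_two_iff_exists_subgroup`), `CMTypeRankCharacters`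
(`IsCMTypeWith.typeRank_eq_one_add_ncard_oddCharacters`).
-/

open scoped BigOperators Classical

namespace Literature.NumberTheory.ComplexMultiplication

namespace CyclicCMType

namespace ExponentTwo

variable {G : Type*} [CommGroup G] [Fintype G] [DecidableEq G] {ρ : G} {T : Finset G}

/-! ## §0 Helpers -/

section Helpers

omit [Fintype G] [DecidableEq G] in
/-- `g·g = 1` in exponent `2`. [folklore] -/
private theorem mul_self_eq_one_st (hexp : ∀ g : G, g ^ 2 = 1) (g : G) : g * g = 1 := by
  rw [← pow_two]; exact hexp g

omit [Fintype G] [DecidableEq G] in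
/-- `χ(gh) = χ(g)χ(h)`. [folklore] -/
private theorem char_mul_st (χ : AddChar (Additive G) ℂ) (g h : G) :
    χ (Additive.ofMul (g * h)) = χ (Additive.ofMul g) * χ (Additive.ofMul h) := by
  rw [ofMul_mul, AddChar.map_add_eq_mul]

omit [Fintype G] [DecidableEq G] in
/-- `ρ² = 1`. [folklore] -/
private theorem rho_mul_rho_st (h : IsCMTypeWith ρ (T : Set G)) : ρ * ρ = 1 := by
  have := h.invol (1 : G)
  simpa [smul_eq_mul] using this

omit [Fintype G] [DecidableEq G] in
/-- `ρx ∈ T ⟺ x ∉ T`. [folklore] -/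
private theorem rho_mul_mem_iff_st (h : IsCMTypeWith ρ (T : Set G)) (x : G) : ρ * x ∈ T ↔ x ∉ T := by
  have := h.rho_smul_mem_iff x
  simpa only [smul_eq_mul, Finset.mem_coe] using this

/-- `|G| = 2|T|`. [folklore] -/
private theorem two_mul_card_st (h : IsCMTypeWith ρ (T : Set G)) : 2 * T.card = Fintype.card G := by
  have hinj : Function.Injective fun s : G => ρ * s := fun a b hab => mul_left_cancel hab
  have hc : Tᶜ = T.image fun s => ρ * s := by
    ext x
    rw [Finset.mem_compl, Finset.mem_image]
    constructor
    · intro hx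
      refine ⟨ρ * x, (rho_mul_mem_iff_st h x).2 hx, ?_⟩
      rw [← mul_assoc, rho_mul_rho_st h, one_mul]
    · rintro ⟨s, hs, rfl⟩
      exact fun hx => ((rho_mul_mem_iff_st h s).1 hx) hs
  have h1 : Tᶜ.card = T.card := by rw [hc, Finset.card_image_of_injective _ hinj]
  have h2 := Finset.card_add_card_compl T
  omega

omit [DecidableEq G] in
/-- The set of surviving odd characters as a finset. [cite: Kubota1965, §4 Lemma 2] -/
private theorem ncard_survivors_eq_st (T : Finset G) (ρ : G) :
    {χ : AddChar (Additive G) ℂ | χ (Additive.ofMul ρ) = -1 ∧ ∑ s ∈ T, χ (Additive.ofMul s) ≠ 0}.ncard =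
      ((Finset.univ.filter fun χ : AddChar (Additive G) ℂ => χ (Additive.ofMul ρ) = -1).filter
        fun χ => ∑ s ∈ T, χ (Additive.ofMul s) ≠ 0).card := by
  rw [← Set.ncard_coe_finset]
  congr 1
  ext χ
  simp only [Set.mem_setOf_eq, Finset.coe_filter, Finset.mem_filter, Finset.mem_univ, true_and]

/-- Kubota's count with the survivors as a finset: `rank = 1 + #surv`. [cite: Kubota1965, §4 Lemma 2] -/
private theorem typeRank_eq_one_add_card_st (h : IsCMTypeWith ρ (T : Set G)) :
    typeRank G (T : Set G) = 1 + ((Finset.univ.filter fun χ : AddChar (Additive G) ℂ =>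
      χ (Additive.ofMul ρ) = -1).filter fun χ => ∑ s ∈ T, χ (Additive.ofMul s) ≠ 0).card := by
  rw [h.typeRank_eq_one_add_ncard_oddCharacters, ncard_survivors_eq_st]

end Helpers

/-! ## §1 The profile of the sign counts in order `32` -/

section Profile

/-- **The five solutions**: for an EVEN CM type in order `32` (all `a_χ(T)` even), with
`n_v = #{χ odd : (8 − a_χ)² = v}`: `16n₆₄ + 9n₃₆ + 4n₁₆ + n₄ = 16`, `Σ n_v = 16`, `n₃₆ + n₄ ∈ {0, 8, 16}` and
`rank = 17 − n₀`. [cite: Kubota1965, §4 Lemma 2] [cite: Dodson1984, §3.1.1 Theorem] -/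
theorem profile_of_card_thirtytwo (hexp : ∀ g : G, g ^ 2 = 1) (h : IsCMTypeWith ρ (T : Set G))
    (h32 : Fintype.card G = 32)
    (hev : ∀ χ : AddChar (Additive G) ℂ, χ (Additive.ofMul ρ) = -1 →
      Even (T.filter fun s => χ (Additive.ofMul s) = -1).card) :
    16 * ((Finset.univ.filter fun χ : AddChar (Additive G) ℂ => χ (Additive.ofMul ρ) = -1).filter fun χ =>
          (T.filter fun s => χ (Additive.ofMul s) = -1).card = 0 ∨
          (T.filter fun s => χ (Additive.ofMul s) = -1).card = 16).card +
      9 * ((Finset.univ.filter fun χ : AddChar (Additive G) ℂ => χ (Additive.ofMul ρ) = -1).filter fun χ =>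
          (T.filter fun s => χ (Additive.ofMul s) = -1).card = 2 ∨
          (T.filter fun s => χ (Additive.ofMul s) = -1).card = 14).card +
      4 * ((Finset.univ.filter fun χ : AddChar (Additive G) ℂ => χ (Additive.ofMul ρ) = -1).filter fun χ =>
          (T.filter fun s => χ (Additive.ofMul s) = -1).card = 4 ∨
          (T.filter fun s => χ (Additive.ofMul s) = -1).card = 12).card +
      ((Finset.univ.filter fun χ : AddChar (Additive G) ℂ => χ (Additive.ofMul ρ) = -1).filter fun χ =>
          (T.filter fun s => χ (Additive.ofMul s) = -1).card = 6 ∨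
          (T.filter fun s => χ (Additive.ofMul s) = -1).card = 10).card = 16 ∧
    ((Finset.univ.filter fun χ : AddChar (Additive G) ℂ => χ (Additive.ofMul ρ) = -1).filter fun χ =>
          (T.filter fun s => χ (Additive.ofMul s) = -1).card = 0 ∨
          (T.filter fun s => χ (Additive.ofMul s) = -1).card = 16).card +
      ((Finset.univ.filter fun χ : AddChar (Additive G) ℂ => χ (Additive.ofMul ρ) = -1).filter fun χ =>
          (T.filter fun s => χ (Additive.ofMul s) = -1).card = 2 ∨
          (T.filter fun s => χ (Additive.ofMul s) = -1).card = 14).card +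
      ((Finset.univ.filter fun χ : AddChar (Additive G) ℂ => χ (Additive.ofMul ρ) = -1).filter fun χ =>
          (T.filter fun s => χ (Additive.ofMul s) = -1).card = 4 ∨
          (T.filter fun s => χ (Additive.ofMul s) = -1).card = 12).card +
      ((Finset.univ.filter fun χ : AddChar (Additive G) ℂ => χ (Additive.ofMul ρ) = -1).filter fun χ =>
          (T.filter fun s => χ (Additive.ofMul s) = -1).card = 6 ∨
          (T.filter fun s => χ (Additive.ofMul s) = -1).card = 10).card +
      ((Finset.univ.filter fun χ : AddChar (Additive G) ℂ => χ (Additive.ofMul ρ) = -1).filter fun χ =>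
          (T.filter fun s => χ (Additive.ofMul s) = -1).card = 8).card = 16 ∧
    (((Finset.univ.filter fun χ : AddChar (Additive G) ℂ => χ (Additive.ofMul ρ) = -1).filter fun χ =>
          (T.filter fun s => χ (Additive.ofMul s) = -1).card = 2 ∨
          (T.filter fun s => χ (Additive.ofMul s) = -1).card = 14).card +
      ((Finset.univ.filter fun χ : AddChar (Additive G) ℂ => χ (Additive.ofMul ρ) = -1).filter fun χ =>
          (T.filter fun s => χ (Additive.ofMul s) = -1).card = 6 ∨
          (T.filter fun s => χ (Additive.ofMul s) = -1).card = 10).card = 0 ∨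
     ((Finset.univ.filter fun χ : AddChar (Additive G) ℂ => χ (Additive.ofMul ρ) = -1).filter fun χ =>
          (T.filter fun s => χ (Additive.ofMul s) = -1).card = 2 ∨
          (T.filter fun s => χ (Additive.ofMul s) = -1).card = 14).card +
      ((Finset.univ.filter fun χ : AddChar (Additive G) ℂ => χ (Additive.ofMul ρ) = -1).filter fun χ =>
          (T.filter fun s => χ (Additive.ofMul s) = -1).card = 6 ∨
          (T.filter fun s => χ (Additive.ofMul s) = -1).card = 10).card = 8 ∨
     ((Finset.univ.filter fun χ : AddChar (Additive G) ℂ => χ (Additive.ofMul ρ) = -1).filter fun χ =>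
          (T.filter fun s => χ (Additive.ofMul s) = -1).card = 2 ∨
          (T.filter fun s => χ (Additive.ofMul s) = -1).card = 14).card +
      ((Finset.univ.filter fun χ : AddChar (Additive G) ℂ => χ (Additive.ofMul ρ) = -1).filter fun χ =>
          (T.filter fun s => χ (Additive.ofMul s) = -1).card = 6 ∨
          (T.filter fun s => χ (Additive.ofMul s) = -1).card = 10).card = 16) ∧
    typeRank G (T : Set G) + ((Finset.univ.filter fun χ : AddChar (Additive G) ℂ => χ (Additive.ofMul ρ) = -1).filter
        fun χ => (T.filter fun s => χ (Additive.ofMul s) = -1).card = 8).card = 17 := by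
  have hT : T.card = 16 := by have := two_mul_card_st h; omega
  set O := Finset.univ.filter (fun χ : AddChar (Additive G) ℂ => χ (Additive.ofMul ρ) = -1) with hO
  set a : AddChar (Additive G) ℂ → ℕ := fun χ => (T.filter fun s => χ (Additive.ofMul s) = -1).card with ha
  have hOcard : O.card = 16 := by
    have := two_mul_card_odd_eq (T := T) h; rw [← hO, h32] at this; omega
  have hmemO : ∀ χ, χ ∈ O ↔ χ (Additive.ofMul ρ) = -1 := fun χ => by
    rw [hO, Finset.mem_filter]; exact ⟨fun hh => hh.2, fun hh => ⟨Finset.mem_univ _, hh⟩⟩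
  have hev' : ∀ χ : AddChar (Additive G) ℂ, χ (Additive.ofMul ρ) = -1 → Even (a χ) := hev
  have hale : ∀ χ, a χ ≤ 16 := fun χ => by rw [← hT]; exact Finset.card_filter_le _ _
  set n64 := (O.filter fun χ => a χ = 0 ∨ a χ = 16).card with hn64
  set n36 := (O.filter fun χ => a χ = 2 ∨ a χ = 14).card with hn36
  set n16 := (O.filter fun χ => a χ = 4 ∨ a χ = 12).card with hn16
  set n4 := (O.filter fun χ => a χ = 6 ∨ a χ = 10).card with hn4
  set n0 := (O.filter fun χ => a χ = 8).card with hn0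
  -- Parseval
  have hP := sum_odd_sq_eq_int hexp h
  rw [hT] at hP
  have hpt : ∀ χ ∈ O, ((16 : ℤ) - 2 * (a χ : ℤ)) ^ 2 =
      256 * (if a χ = 0 ∨ a χ = 16 then 1 else 0) + 144 * (if a χ = 2 ∨ a χ = 14 then 1 else 0) +
      64 * (if a χ = 4 ∨ a χ = 12 then 1 else 0) + 16 * (if a χ = 6 ∨ a χ = 10 then 1 else 0) := by
    intro χ hχ
    have hle := hale χ
    obtain ⟨b, hb⟩ := hev' χ ((hmemO χ).1 hχ)
    have hb8 : b ≤ 8 := by omega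
    rw [hb]
    interval_cases b <;> norm_num
  have hsumP : ∑ χ ∈ O, ((16 : ℤ) - 2 * (a χ : ℤ)) ^ 2 =
      256 * (n64 : ℤ) + 144 * (n36 : ℤ) + 64 * (n16 : ℤ) + 16 * (n4 : ℤ) := by
    rw [Finset.sum_congr rfl hpt, Finset.sum_add_distrib, Finset.sum_add_distrib, Finset.sum_add_distrib,
      ← Finset.mul_sum, ← Finset.mul_sum, ← Finset.mul_sum, ← Finset.mul_sum, Finset.sum_boole, Finset.sum_boole,
      Finset.sum_boole, Finset.sum_boole]
  have hP' : ∑ χ ∈ O, ((16 : ℤ) - 2 * (a χ : ℤ)) ^ 2 = 256 := by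
    simp only [hO, ha]
    exact_mod_cast hP
  rw [hsumP] at hP'
  -- partition
  have hpart : ∀ χ ∈ O, ((if a χ = 0 ∨ a χ = 16 then 1 else 0 : ℕ) + (if a χ = 2 ∨ a χ = 14 then 1 else 0) +
      (if a χ = 4 ∨ a χ = 12 then 1 else 0) + (if a χ = 6 ∨ a χ = 10 then 1 else 0) +
      (if a χ = 8 then 1 else 0)) = 1 := by
    intro χ hχ
    have hle := hale χ
    obtain ⟨b, hb⟩ := hev' χ ((hmemO χ).1 hχ)
    have hb8 : b ≤ 8 := by omega
    rw [hb]
    interval_cases b <;> norm_num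
  have hsum1 : n64 + n36 + n16 + n4 + n0 = 16 := by
    have hs := Finset.sum_congr (rfl : O = O) hpart
    rw [Finset.sum_add_distrib, Finset.sum_add_distrib, Finset.sum_add_distrib, Finset.sum_add_distrib,
      Finset.sum_boole, Finset.sum_boole, Finset.sum_boole, Finset.sum_boole, Finset.sum_boole, Finset.sum_const,
      smul_eq_mul, mul_one, hOcard] at hs
    simp only [Nat.cast_id] at hs
    exact hs
  -- balance
  have hbal := card_filter_mod_four_mem hexp h h32 hev
  have hO₂ : (O.filter fun χ => a χ % 4 = 2).card = n36 + n4 := by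
    rw [hn36, hn4, ← Finset.card_union_of_disjoint (Finset.disjoint_filter.2 fun χ _ h1 h2 => by omega),
      ← Finset.filter_or]
    congr 1
    refine Finset.filter_congr fun χ hχ => ?_
    have hle := hale χ
    obtain ⟨b, hb⟩ := hev' χ ((hmemO χ).1 hχ)
    have hb8 : b ≤ 8 := by omega
    rw [hb]
    interval_cases b <;> norm_num
  simp only [← hO] at hbal
  rw [hO₂] at hbal
  -- survivors
  have hrank := typeRank_eq_one_add_card_st h
  rw [← hO] at hrank
  have hsurv : (O.filter fun χ => ∑ s ∈ T, χ (Additive.ofMul s) ≠ 0).card = 16 - n0 := by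
    have hcompl : (O.filter fun χ => ∑ s ∈ T, χ (Additive.ofMul s) ≠ 0) = O.filter fun χ => ¬ a χ = 8 := by
      refine Finset.filter_congr fun χ _ => ?_
      rw [Ne, sum_char_eq_zero_iff_two_mul_card_filter_eq hexp χ T, hT]
      simp only [ha]
      omega
    rw [hcompl, Finset.filter_not, Finset.card_sdiff_of_subset (Finset.filter_subset _ _), hOcard]
  rw [hsurv] at hrank
  have hn0le : n0 ≤ 16 := by rw [hn0, ← hOcard]; exact Finset.card_filter_le _ _
  have e1 : 16 * n64 + 9 * n36 + 4 * n16 + n4 = 16 := by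
    clear hpt hpart hsumP hP hrank hsurv
    omega
  have e4 : typeRank G (T : Set G) + n0 = 17 := by
    clear hpt hpart hsumP hP hsurv e1
    omega
  exact ⟨e1, hsum1, hbal, e4⟩

/-- **A degenerate type in order `32` is even**: `rank(T) ≠ 17` ⟹ every sign count `a_χ(T)`, `χ` odd, is even
(tree `even_card_filter_of_typeRank_ne`, packaged). [cite: Kubota1965, §4 Lemma 2] [cite: Dodson1984, §3.1.1 Theorem] -/
theorem forall_even_of_typeRank_ne_of_card_thirtytwo (hexp : ∀ g : G, g ^ 2 = 1) (h : IsCMTypeWith ρ (T : Set G))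
    (h32 : Fintype.card G = 32) (hne : typeRank G (T : Set G) ≠ 17) :
    ∀ χ : AddChar (Additive G) ℂ, χ (Additive.ofMul ρ) = -1 →
      Even (T.filter fun s => χ (Additive.ofMul s) = -1).card := by
  intro χ hχ
  exact even_card_filter_of_typeRank_ne hexp h (by rw [h32]; norm_num) (by rw [h32]; norm_num; exact hne) hχ

/-- **RANK `9` ⟹ SOME SIGN COUNT IS `2` OR `14`** (order `32`): the profile of rank `9` is `n₃₆ = 1, n₄ = 7,
n₀ = 8`; so the type is at distance one conjugate pair from an index-`2` coset (tree `WeightTwo`).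
[cite: Kubota1965, §4 Lemma 2] [cite: Dodson1984, §3.1.1 Theorem] -/
theorem exists_card_filter_mem_of_typeRank_eq_nine (hexp : ∀ g : G, g ^ 2 = 1) (h : IsCMTypeWith ρ (T : Set G))
    (h32 : Fintype.card G = 32) (hr : typeRank G (T : Set G) = 9) :
    ∃ χ : AddChar (Additive G) ℂ, χ (Additive.ofMul ρ) = -1 ∧
      ((T.filter fun s => χ (Additive.ofMul s) = -1).card = 2 ∨ (T.filter fun s => χ (Additive.ofMul s) = -1).card = 14) := by
  have hev := forall_even_of_typeRank_ne_of_card_thirtytwo hexp h h32 (by rw [hr]; norm_num)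
  obtain ⟨e1, e2, hbal, hrk⟩ := profile_of_card_thirtytwo hexp h h32 hev
  rw [hr] at hrk
  have hpos : 0 < ((Finset.univ.filter fun χ : AddChar (Additive G) ℂ => χ (Additive.ofMul ρ) = -1).filter fun χ =>
      (T.filter fun s => χ (Additive.ofMul s) = -1).card = 2 ∨
      (T.filter fun s => χ (Additive.ofMul s) = -1).card = 14).card := by
    rcases hbal with hb | hb | hb <;> omega
  obtain ⟨χ, hχ⟩ := Finset.card_pos.1 hpos
  rw [Finset.mem_filter, Finset.mem_filter] at hχ
  exact ⟨χ, hχ.1.2, hχ.2⟩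

end Profile

/-! ## §2 Order `32`: the stabilisers of each rank -/

section Stabilizers

/-- **RANK `9` ⟹ A NON-TRIVIAL STABILISER** (order `32`): the type has a sign count `2` or `14`, hence is stabilised
by the product of its two exceptional elements (tree `WeightTwo`/g38-#5 group level, via
`AbelianStabilizer.forall_mul_mem_iff_of_forall_survivor`). [cite: Kubota1965, §4 Lemma 2] [cite: Dodson1984, §3.1.1 Theorem] -/
theorem exists_ne_one_forall_mul_mem_iff_of_typeRank_eq_nine (hexp : ∀ g : G, g ^ 2 = 1)
    (h : IsCMTypeWith ρ (T : Set G)) (h32 : Fintype.card G = 32) (hr : typeRank G (T : Set G) = 9) :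
    ∃ g : G, g ≠ 1 ∧ ∀ t : G, t * g ∈ T ↔ t ∈ T := by
  obtain ⟨χ₁, hχ₁, h2 | h14⟩ := exists_card_filter_mem_of_typeRank_eq_nine hexp h h32 hr
  · -- `a = 2`: the two exceptional elements `u ≠ v`, `uv` stabilises
    obtain ⟨u, v, huv, hT⟩ := Finset.card_eq_two.1 h2
    have hu : χ₁ (Additive.ofMul u) = -1 := by
      have : u ∈ T.filter (fun s => χ₁ (Additive.ofMul s) = -1) := by rw [hT]; simp
      exact (Finset.mem_filter.1 this).2
    have hv : χ₁ (Additive.ofMul v) = -1 := by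
      have : v ∈ T.filter (fun s => χ₁ (Additive.ofMul s) = -1) := by rw [hT]; simp
      exact (Finset.mem_filter.1 this).2
    refine ⟨u * v, fun h1 => huv ?_, fun t => ?_⟩
    · have := congrArg (fun z => z * v) h1
      simp only [mul_assoc, mul_self_eq_one_st hexp v, mul_one, one_mul] at this
      exact this
    · refine AbelianStabilizer.forall_mul_mem_iff_of_forall_survivor h (fun χ hχ hS => ?_) t
      by_cases hne : χ = χ₁
      · rw [hne, char_mul_st, hu, hv]; norm_num
      · exact (sum_char_ne_zero_iff_apply_mul_eq_one hexp h hχ₁ hT huv hχ hne).1 hS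
  · -- `a = 14 = |T| − 2`: pass to the complement, which has `a = 2` and the same stabiliser
    have hT16 : T.card = 16 := by have := two_mul_card_st h; omega
    have hχ0 : χ₁ ≠ 0 := fun h0 => by rw [h0, AddChar.zero_apply] at hχ₁; norm_num at hχ₁
    have hc := card_filter_compl_add_eq hexp hχ0 T
    rw [h32] at hc
    have h2' : (Tᶜ.filter fun s => χ₁ (Additive.ofMul s) = -1).card = 2 := by omega
    have hcT := isCMTypeWith_compl h
    obtain ⟨u, v, huv, hT⟩ := Finset.card_eq_two.1 h2'
    have hu : χ₁ (Additive.ofMul u) = -1 := by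
      have : u ∈ Tᶜ.filter (fun s => χ₁ (Additive.ofMul s) = -1) := by rw [hT]; simp
      exact (Finset.mem_filter.1 this).2
    have hv : χ₁ (Additive.ofMul v) = -1 := by
      have : v ∈ Tᶜ.filter (fun s => χ₁ (Additive.ofMul s) = -1) := by rw [hT]; simp
      exact (Finset.mem_filter.1 this).2
    refine ⟨u * v, fun h1 => huv ?_, fun t => ?_⟩
    · have := congrArg (fun z => z * v) h1
      simp only [mul_assoc, mul_self_eq_one_st hexp v, mul_one, one_mul] at this
      exact this
    · have key : t * (u * v) ∈ Tᶜ ↔ t ∈ Tᶜ := by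
        refine AbelianStabilizer.forall_mul_mem_iff_of_forall_survivor hcT (fun χ hχ hS => ?_) t
        by_cases hne : χ = χ₁
        · rw [hne, char_mul_st, hu, hv]; norm_num
        · exact (sum_char_ne_zero_iff_apply_mul_eq_one hexp hcT hχ₁ hT huv hχ hne).1 hS
      rw [Finset.mem_compl, Finset.mem_compl] at key
      tauto

/-- **RANK `2` ⟹ A NON-TRIVIAL STABILISER** (every order `≥ 8`... here order `32`): the type is a coset of an
index-`2` subgroup `H ∌ ρ`, and every `1 ≠ g ∈ H` stabilises it. [cite: Kubota1965, §4 Lemma 2] -/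
theorem exists_ne_one_forall_mul_mem_iff_of_typeRank_eq_two (hexp : ∀ g : G, g ^ 2 = 1)
    (h : IsCMTypeWith ρ (T : Set G)) (h32 : Fintype.card G = 32) (hr : typeRank G (T : Set G) = 2) :
    ∃ g : G, g ≠ 1 ∧ ∀ t : G, t * g ∈ T ↔ t ∈ T := by
  obtain ⟨H, -, hidx, hTH⟩ := (typeRank_eq_two_iff_exists_subgroup hexp h).1 hr
  have hHne : H ≠ ⊥ := fun hb => by
    rw [hb, Subgroup.index_bot, Nat.card_eq_fintype_card, h32] at hidx
    omega
  obtain ⟨⟨g, hgH⟩, hg1⟩ := Subgroup.ne_bot_iff_exists_ne_one.1 hHne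
  have hg1' : g ≠ 1 := fun h1 => hg1 (Subtype.ext h1)
  refine ⟨g, hg1', fun u => ?_⟩
  have hmemH : u * g ∈ H ↔ u ∈ H :=
    ⟨fun hu => by simpa using H.mul_mem hu (H.inv_mem hgH), fun hu => H.mul_mem hu hgH⟩
  rcases hTH with hTH | hTH
  · have hiff : ∀ w : G, w ∈ T ↔ w ∈ H := fun w => by rw [← Finset.mem_coe, hTH, SetLike.mem_coe]
    rw [hiff, hiff, hmemH]
  · have hiff : ∀ w : G, w ∈ T ↔ w ∉ H := fun w => by
      rw [← Finset.mem_coe, hTH, Set.mem_compl_iff, SetLike.mem_coe]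
    rw [hiff, hiff, hmemH]

/-- **RANK `> 9` ⟹ TRIVIAL STABILISER** (order `32`): a stabilising `g ≠ 1` would force `rank ≤ 32/4 + 1 = 9`.
[cite: Kubota1965, §2 and §4 Lemma 2] -/
theorem eq_one_of_forall_mul_mem_iff_of_nine_lt_typeRank (hexp : ∀ g : G, g ^ 2 = 1)
    (h : IsCMTypeWith ρ (T : Set G)) (h32 : Fintype.card G = 32) (hr : 9 < typeRank G (T : Set G)) {g : G}
    (hg : ∀ t : G, t * g ∈ T ↔ t ∈ T) : g = 1 := by
  by_contra hg1
  have := typeRank_le_of_forall_mul_mem_iff hexp h hg1 hg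
  rw [h32] at this
  omega

/-- **ORDER `32`: IMPRIMITIVE ⟺ RANK `≤ 9`** — a CM type on `(ℤ/2)⁵` has a non-trivial stabiliser iff its rank is
`2`, `5` or `9`; it is primitive (trivial stabiliser) iff its rank is `11` or `17`. [cite: Kubota1965, §2 and §4 Lemma 2]
[cite: Dodson1984, §3.1.1 Theorem] -/
theorem exists_ne_one_forall_mul_mem_iff_iff_typeRank_le_nine (hexp : ∀ g : G, g ^ 2 = 1)
    (h : IsCMTypeWith ρ (T : Set G)) (h32 : Fintype.card G = 32) :
    (∃ g : G, g ≠ 1 ∧ ∀ t : G, t * g ∈ T ↔ t ∈ T) ↔ typeRank G (T : Set G) ≤ 9 := by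
  constructor
  · rintro ⟨g, hg1, hg⟩
    have := typeRank_le_of_forall_mul_mem_iff hexp h hg1 hg
    rw [h32] at this
    omega
  · intro hle
    rcases typeRank_mem_of_card_thirtytwo hexp h h32 with h17 | h11 | h9 | h5 | h2
    · omega
    · omega
    · exact exists_ne_one_forall_mul_mem_iff_of_typeRank_eq_nine hexp h h32 h9
    · exact exists_ne_one_forall_mul_mem_iff_of_typeRank_eq_five_of_le hexp h (by rw [h32]; norm_num) h5
    · exact exists_ne_one_forall_mul_mem_iff_of_typeRank_eq_two hexp h h32 h2

/-- **ORDER `32`: a type with TRIVIAL stabiliser (primitive) has rank `11` or `17`.** [cite: Kubota1965, §2 and §4 Lemma 2] -/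
theorem typeRank_eq_eleven_or_seventeen_of_forall (hexp : ∀ g : G, g ^ 2 = 1) (h : IsCMTypeWith ρ (T : Set G))
    (h32 : Fintype.card G = 32) (hprim : ∀ g : G, g ≠ 1 → ∃ t : G, ¬ (t * g ∈ T ↔ t ∈ T)) :
    typeRank G (T : Set G) = 11 ∨ typeRank G (T : Set G) = 17 := by
  have hnot : ¬ ∃ g : G, g ≠ 1 ∧ ∀ t : G, t * g ∈ T ↔ t ∈ T := by
    rintro ⟨g, hg1, hg⟩
    obtain ⟨t, ht⟩ := hprim g hg1
    exact ht (hg t)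
  rw [exists_ne_one_forall_mul_mem_iff_iff_typeRank_le_nine hexp h h32] at hnot
  rcases typeRank_mem_of_card_thirtytwo hexp h h32 with h1 | h1 | h1 | h1 | h1 <;> omega

end Stabilizers

end ExponentTwo

end CyclicCMType

end Literature.NumberTheory.ComplexMultiplication
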